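import Literature.MathematicalPhysics.KineticTheory.InfiniteChainShiftInvariantUniqueness
import Literature.MathematicalPhysics.KineticTheory.InfiniteChainSuperstableDynamics
import Literature.MathematicalPhysics.KineticTheory.InfiniteChainInvariantStates
import HarnessLib

/-!
# `stub_regularDLRUnique` — DLR uniqueness in the regular class (line `temperature-blind-vitali-hurwitz`,
crux `EmbeddedDrudeMourre.GreenKuboContinuation`, item stmt-AtomisticToContinuum-12597)

Registered stub 2 of the line's skeleton (`Cruxes/GreenKuboContinuation/Lines/temperature_blind_vitali_hurwitz.lean`,
rev 7): for the pinned anharmonic chain `pinnedChain ω₂ lam β γ` (all parameters `> 0`) and every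
`T > 0`, any two DLR Gibbs states at `T` that are shift-invariant and satisfy Buttà–Marchioro's
superstability estimate (2.3) coincide. It is the hypothesis `hU` fed to stubs 1c, 4 and 6 of the
composition `continuation_of_modulus`.

PROVED — and more: the superstability hypotheses are idle. The Literature theorem
`OscillatorChain.eq_of_isChainGibbsMeasure_of_isShiftInvariant_pinnedChain`
(`InfiniteChainShiftInvariantUniqueness.lean`; transfer operator on `L²` of the one-site a priori
measure, Perron–Frobenius–Jentzsch gap, boundary-independence of interval Gibbs kernels uniformly on
exhausting sets of boundary spins, shift invariance of the one-site marginal; Cassandro–Olivieri–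
Pellegrinotti–Presutti 1978 §3, Georgii 2011 Ch. 10–11) gives uniqueness among ALL shift-invariant
DLR states (`ω₂ > 0`, `lam, β ≥ 0`).
-/

noncomputable section

namespace Summit.AtomisticToContinuum.FouriersLaw.Theorems.GreenKuboContinuation.TemperatureBlindVitaliHurwitz

open MeasureTheory
open Literature.MathematicalPhysics.KineticTheory.HeatConduction

/-- **Stub 2 of line `temperature-blind-vitali-hurwitz` — DLR UNIQUENESS IN THE REGULAR CLASS**
(registered signature, verbatim): for `pinnedChain ω₂ lam β γ` (all `> 0`) and every `T > 0`, two
DLR Gibbs states at `T` which are shift-invariant and BM-superstable are equal. One line from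
`OscillatorChain.eq_of_isChainGibbsMeasure_of_isShiftInvariant_pinnedChain` (the superstability
hypotheses are not used). [cite: Georgii2011, Thm 10.25 and §11.1] -/
theorem stub_regularDLRUnique :
    ∀ ω₂ lam β γ : ℝ, 0 < ω₂ → 0 < lam → 0 < β → 0 < γ →
      ∀ T : ℝ, 0 < T →
        ∀ μ₁ μ₂ : MeasureTheory.Measure
            Literature.MathematicalPhysics.KineticTheory.HeatConduction.ChainConfig,
          (Literature.MathematicalPhysics.KineticTheory.HeatConduction.pinnedChain
                ω₂ lam β γ).IsChainGibbsMeasure T μ₁ →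
          Literature.MathematicalPhysics.KineticTheory.HeatConduction.IsShiftInvariant μ₁ →
          (Literature.MathematicalPhysics.KineticTheory.HeatConduction.pinnedChain
                ω₂ lam β γ).HasSuperstabilityEstimate μ₁ →
          (Literature.MathematicalPhysics.KineticTheory.HeatConduction.pinnedChain
                ω₂ lam β γ).IsChainGibbsMeasure T μ₂ →
          Literature.MathematicalPhysics.KineticTheory.HeatConduction.IsShiftInvariant μ₂ →
          (Literature.MathematicalPhysics.KineticTheory.HeatConduction.pinnedChain
                ω₂ lam β γ).HasSuperstabilityEstimate μ₂ → μ₁ = μ₂ := by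
  intro ω₂ lam β γ hω hl hβ _hγ T hT μ₁ μ₂ h₁ hS₁ _hSS₁ h₂ hS₂ _hSS₂
  exact OscillatorChain.eq_of_isChainGibbsMeasure_of_isShiftInvariant_pinnedChain γ hω hl.le hβ.le
    hT h₁ hS₁ h₂ hS₂

end Summit.AtomisticToContinuum.FouriersLaw.Theorems.GreenKuboContinuation.TemperatureBlindVitaliHurwitz

end
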